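import Literature.NumberTheory.Automorphic.HidaWeightTwistSymbols
import HarnessLib

/-!
# The symbol ring of the levelwise support argument: good Hecke symbols and global torus data

Topic `NumberTheory/Automorphic`; namespaces `Literature.NumberTheory.Automorphic.BigHeckeGLn`
(`TorusDatum`) and `Literature.NumberTheory.Automorphic.BigHeckeGLn.TameLevel`; definitions with
bodies and theorems (no named fact, no `sorry`).

The levelwise form of the support argument of Hida's control theorem
([Hida1994AIF, §3, proof of Thm 3.2]; [KhareThorne2017, §6.5, Lemma 6.17]) compares the ordinary
cohomology of the Hida tower (trivial coefficients) with the ordinary weight-`k` cohomology.  The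
comparison (independence of weight, [KhareThorne2017, Prop. 6.13]) is Hecke-equivariant ON THE NOSE
only for the operators `T_{w,j}` at the GOOD places `w ∉ S` (every place above `p` is in `S`; the
central `U_{v,2}`, `v ∣ p`, is twisted by `ϖ_v^{k-2}`), and for the diamond operators of GLOBAL
torus elements it is twisted by the INTEGER `N_{K/ℚ}(u)^{k-2}`.  This file sets up the corresponding
free commutative ring of symbols over a coefficient ring `O`:

* `goodElements 𝒰` — the Hecke elements `t_{w,j}`, `w ∉ S` (`⊆ hidaElements`);
* `TorusDatum K p c₀` — a pair `d = (d⁰, d¹)` of global unit data of depth `c₀`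
  (`GlobalUnitDatum`: `uⁱ ∈ 𝓞 K`, `uⁱ ≡ 1 (mod p^{c₀})`, with local units `ûⁱ_v = uⁱ`), its diagonal
  units `d.units v = (û⁰_v, û¹_v)` and the torus element `torusElement d = ∏_{v ∣ p} ⟨(û⁰_v, û¹_v)⟩_v`
  (`diamondPi`), which lies in and normalises every Hida level `U(b, c)`, `b ≤ c₀`;
* **`exists_torusDatum_forall_mul_inv_mem_torusBall`** — every `u ∈ ∏_{v ∣ p} T_v(b₁)` with
  `b₁ ≥ e_v c₀` (`e_v = ord_v p`) is congruent modulo `∏_v T_v(c)` to the units of a torus datum of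
  depth `c₀` (density of `𝓞 K` in `∏_{v ∣ p} 𝒪_v` and the Chinese remainder theorem), whence
  **`exists_torusDatum_mul_inv_mem_level`**: every coset of `U(b₁, c)/U(c, c)` contains a torus
  element of depth `c₀`;
* `Syms 𝒰 c₀ = goodElements ⊕ TorusDatum`, the symbol map
  `symbolMap : ℤ[Syms] → ℤ[T^abs]` (`X_d ↦ ∏_v X_{⟨(û⁰_v, û¹_v)⟩_v}`), and over any commutative ring `O`
  with `σ : O → A`: the character **`symChar σ a`** (`eval₂Hom`), the weight twist
  **`symTwist k`** (`X_d ↦ N(u¹_d)^{k-2} X_d`, identity on good symbols), the finite weight ideals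
  `symWeightIdeal k a = (symTwist k (X_{a t}) - 1)_t`, and
  **`symChar_symTwist_X_inr`**: a point whose diamond values are those of weight `k`
  (`∏_v x⟨(1, û_v)⟩_v = N(u)^{2-k}`, `∏_v x⟨(û_v, 1)⟩_v = 1`, `HasDominantDiamondWeight.exists_forall_eq`)
  kills every weight ideal (`symChar_eq_zero_of_mem_symWeightIdeal`,
  `exists_depth_forall_symChar_symTwist_eq_one`).

## References

* H. Hida, Ann. Inst. Fourier 44 (1994), §1 p. 1293, §3. [Hida1994AIF]
* C. Khare, J. A. Thorne, Amer. J. Math. 139 (2017), §6.3–6.5. [KhareThorne2017]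
-/

noncomputable section

open MvPolynomial IsDedekindDomain
open scoped NumberField

namespace Literature.NumberTheory.Automorphic

namespace BigHeckeGLn

/-! ### Global torus data -/

/-- **A global torus datum of depth `c₀`**: a pair `(d⁰, d¹)` of global unit data (the two diagonal
entries). [cite: KhareThorne2017, §6.3–6.4] -/
abbrev TorusDatum (K : Type) [Field K] [NumberField K] (p : ℕ) (c₀ : ℕ) : Type :=
  GlobalUnitDatum K p c₀ × GlobalUnitDatum K p c₀

namespace TorusDatum

variable {K : Type} [Field K] [NumberField K] {p : ℕ} {c₀ : ℕ}

/-- The diagonal units `(û⁰_v, û¹_v) ∈ T₂(𝒪_v)` of a torus datum at `v ∣ p`. [folklore] -/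
def units (d : TorusDatum K p c₀) (v : PlacesAbove K p) : Fin 2 → (v.1.adicCompletionIntegers K)ˣ :=
  ![d.1.û v.1 v.2, d.2.û v.1 v.2]

/-- Slot `0` of `units`. [folklore] -/
@[simp]
theorem units_zero (d : TorusDatum K p c₀) (v : PlacesAbove K p) : d.units v 0 = d.1.û v.1 v.2 :=
  rfl

/-- Slot `1` of `units`. [folklore] -/
@[simp]
theorem units_one (d : TorusDatum K p c₀) (v : PlacesAbove K p) : d.units v 1 = d.2.û v.1 v.2 :=
  rfl

/-- `units = e₀(û⁰) · e₁(û¹)`. [folklore] -/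
theorem units_eq_mulSingle_mul (d : TorusDatum K p c₀) (v : PlacesAbove K p) :
    d.units v = Pi.mulSingle (0 : Fin 2) (d.1.û v.1 v.2) * Pi.mulSingle (1 : Fin 2) (d.2.û v.1 v.2) := by
  ext i
  fin_cases i <;> simp [units]

/-- The units of a torus datum lie in `T_v(c₀)` (`ûⁱ_v = uⁱ ≡ 1 mod p^{c₀}`). [folklore] -/
theorem units_mem_torusBall (d : TorusDatum K p c₀) (v : PlacesAbove K p) : d.units v ∈ torusBall v.1 c₀ := by
  rw [mem_torusBall_iff]
  intro j
  fin_cases j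
  · change Valued.v (((d.1.û v.1 v.2 : v.1.adicCompletionIntegers K) : v.1.adicCompletion K) - 1) ≤ _
    rw [d.1.compat v.1 v.2]
    exact TameLevel.valued_algebraMap_sub_one_le d.1.cong v.2
  · change Valued.v (((d.2.û v.1 v.2 : v.1.adicCompletionIntegers K) : v.1.adicCompletion K) - 1) ≤ _
    rw [d.2.compat v.1 v.2]
    exact TameLevel.valued_algebraMap_sub_one_le d.2.cong v.2

variable [Fact p.Prime]

/-- **The torus element `∏_{v ∣ p} ⟨(û⁰_v, û¹_v)⟩_v` of a torus datum.** [cite: KhareThorne2017, §6.3] -/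
def torusElement (d : TorusDatum K p c₀) : FiniteAdelicGL 2 K :=
  diamondPi 2 K p d.units

end TorusDatum

/-! ### Simultaneous approximation of local units by global unit data -/

section Approximation

variable {K : Type} [Field K] [NumberField K] {p : ℕ} [Fact p.Prime]

/-- **A global element congruent to given local integers at the places above `p`** (density of
`𝓞 K` in each `𝒪_v` and the Chinese remainder theorem). [folklore] -/
theorem exists_forall_valued_sub_le (c : ℕ) (t : ∀ v : PlacesAbove K p, v.1.adicCompletionIntegers K) :
    ∃ u : 𝓞 K, ∀ v : PlacesAbove K p,
      Valued.v (algebraMap K (v.1.adicCompletion K) (u : K) - (t v : v.1.adicCompletion K)) ≤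
        WithZero.exp (-(c : ℤ)) := by
  classical
  -- local approximations by elements of `𝓞 K` (density of `K` in `K_v`, then of `𝓞 K` in `K ∩ 𝒪_v`)
  have hval : ∀ (v : PlacesAbove K p) (k : K),
      Valued.v (algebraMap K (v.1.adicCompletion K) k) = v.1.valuation K k :=
    fun v k => HeightOneSpectrum.valuedAdicCompletion_eq_valuation' v.1 k
  have hloc : ∀ v : PlacesAbove K p, ∃ r : 𝓞 K,
      Valued.v (algebraMap K (v.1.adicCompletion K) (r : K) - (t v : v.1.adicCompletion K)) ≤
        WithZero.exp (-(c : ℤ)) := by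
    intro v
    set x : v.1.adicCompletion K := (t v : v.1.adicCompletion K) with hx
    have hx1 : Valued.v x ≤ 1 := (HeightOneSpectrum.mem_adicCompletionIntegers (R := 𝓞 K) K v.1).1 (t v).2
    -- the modulus `z = p^c`, `|z|_v ≤ exp(-c)`
    set z : v.1.adicCompletion K := algebraMap K (v.1.adicCompletion K) ((p : K) ^ c) with hzdef
    have hp0 : (p : 𝓞 K) ≠ 0 := Nat.cast_ne_zero.2 (Fact.out : p.Prime).ne_zero
    have hz : z ≠ 0 :=
      (map_ne_zero (algebraMap K (v.1.adicCompletion K))).2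
        (pow_ne_zero _ (Nat.cast_ne_zero.2 (Fact.out : p.Prime).ne_zero))
    have hz' : (Valued.v z : WithZero (Multiplicative ℤ)) ≠ 0 := (Valuation.ne_zero_iff _).2 hz
    have hzc : Valued.v z ≤ WithZero.exp (-(c : ℤ)) := by
      have hp : Valued.v (algebraMap K (v.1.adicCompletion K) (p : K)) ≤ WithZero.exp (-(1 : ℤ)) := by
        have h := valued_algebraMap_eq (K := K) v.1 (u := (p : 𝓞 K)) hp0
        rw [show ((p : 𝓞 K) : K) = (p : K) from rfl] at h
        rw [h, WithZero.exp_le_exp, neg_le_neg_iff, Nat.one_le_cast]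
        exact Nat.pos_of_ne_zero ((ordAt_ne_zero_iff v.1 hp0).2 (Ideal.dvd_span_singleton.2 v.2))
      rw [hzdef, map_pow, map_pow]
      calc Valued.v (algebraMap K (v.1.adicCompletion K) (p : K)) ^ c
          ≤ (WithZero.exp (-(1 : ℤ))) ^ c := pow_le_pow_left' hp c
        _ = WithZero.exp (-(c : ℤ)) := by rw [← WithZero.exp_nsmul]; simp
    -- an element of `K` which is `|z|`-close and `1`-close to `x`
    have hopen : IsOpen ({y : v.1.adicCompletion K | Valued.v (y - x) < Valued.v z} ∩
        {y | Valued.v (y - x) < 1}) := by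
      refine IsOpen.inter ?_ ?_
      · have h1 : IsOpen {y : v.1.adicCompletion K | Valued.v y < Valued.v z} := by
          simpa only [Valuation.restrict_lt_iff] using
            Valued.isOpen_ball (v.1.adicCompletion K) (Valued.v.restrict z)
        exact h1.preimage (continuous_id.sub continuous_const)
      · have h1 : IsOpen {y : v.1.adicCompletion K | Valued.v y < 1} := by
          simpa only [Valuation.restrict_lt_one_iff] using Valued.isOpen_ball (v.1.adicCompletion K) 1
        exact h1.preimage (continuous_id.sub continuous_const)
    obtain ⟨k, hk, hk1'⟩ := (HeightOneSpectrum.denseRange_algebraMap K v.1).exists_mem_open hopen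
      ⟨x, by simp [pos_iff_ne_zero, hz']⟩
    rw [Set.mem_setOf_eq] at hk hk1'
    -- `k` is a `v`-integer of `K`
    have hk1 : v.1.valuation K k ≤ 1 := by
      rw [← hval]
      have := Valuation.map_add Valued.v (algebraMap K (v.1.adicCompletion K) k - x) x
      rw [sub_add_cancel] at this
      exact this.trans (max_le hk1'.le hx1)
    -- approximate `k` by an element of `𝓞 K`
    obtain ⟨r, hr⟩ := v.1.exists_valuation_sub_lt_of_integer hk1 (Units.mk0 _ hz')
    refine ⟨r, ?_⟩
    have h2 : Valued.v (algebraMap K (v.1.adicCompletion K) (r : K) - algebraMap K (v.1.adicCompletion K) k) <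
        Valued.v z := by
      rw [← map_sub, hval, NumberField.RingOfIntegers.coe_eq_algebraMap]
      exact hr
    have := Valuation.map_add Valued.v
      (algebraMap K (v.1.adicCompletion K) (r : K) - algebraMap K (v.1.adicCompletion K) k)
      (algebraMap K (v.1.adicCompletion K) k - x)
    rw [sub_add_sub_cancel] at this
    exact (this.trans (max_le h2.le hk.le)).trans hzc
  choose r hr using hloc
  -- Chinese remainder theorem
  obtain ⟨u, hu⟩ := IsDedekindDomain.exists_forall_sub_mem_ideal (s := (Finset.univ : Finset (PlacesAbove K p)))
    (fun v : PlacesAbove K p => v.1.asIdeal) (fun _ => c) (fun v _ => v.1.prime)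
    (fun v _ w _ hvw => fun h => hvw (Subtype.ext (HeightOneSpectrum.ext h))) fun v => r v.1
  refine ⟨u, fun v => ?_⟩
  have h1 : Valued.v (algebraMap K (v.1.adicCompletion K) (u : K) -
      algebraMap K (v.1.adicCompletion K) (r v : K)) ≤ WithZero.exp (-(c : ℤ)) := by
    have h := valued_algebraMap_le_of_mem_pow (F := K) (hu v (Finset.mem_univ v))
    rwa [show (((u - r v : 𝓞 K)) : K) = (u : K) - (r v : K) by push_cast; ring, map_sub] at h
  have := Valuation.map_add Valued.v
    (algebraMap K (v.1.adicCompletion K) (u : K) - algebraMap K (v.1.adicCompletion K) (r v : K))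
    (algebraMap K (v.1.adicCompletion K) (r v : K) - (t v : v.1.adicCompletion K))
  rw [sub_add_sub_cancel] at this
  exact this.trans (max_le h1 (hr v))

/-- `|x - 1|_v ≤ exp(-m)` for `x ∈ 𝓞 K` forces `x - 1 ∈ v^m`. [folklore] -/
theorem sub_one_mem_pow_of_valued_le {v : HeightOneSpectrum (𝓞 K)} {x : 𝓞 K} {m : ℕ}
    (h : Valued.v (algebraMap K (v.adicCompletion K) (x : K) - 1) ≤ WithZero.exp (-(m : ℤ))) :
    x - 1 ∈ v.asIdeal ^ m := by
  have h1 : ((x : K)) - 1 = ((x - 1 : 𝓞 K) : K) := by push_cast; ring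
  rw [← map_one (algebraMap K (v.adicCompletion K)), ← map_sub, h1, NumberField.RingOfIntegers.coe_eq_algebraMap] at h
  change Valued.v ((algebraMap (𝓞 K) K (x - 1) : v.adicCompletion K)) ≤ _ at h
  rw [HeightOneSpectrum.valuedAdicCompletion_eq_valuation', HeightOneSpectrum.valuation_of_algebraMap] at h
  exact (v.intValuation_le_pow_iff_mem _ m).1 h

/-- **Global unit data approximating local units.**  For units `t_v ∈ 𝒪_v^×` (`v ∣ p`) with
`t_v ≡ 1 mod ϖ_v^{b₁}`, where `b₁ ≥ e_v c₀` (`e_v = ord_v(p)`) and `b₁ ≤ c`, `1 ≤ c`, there is a global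
unit datum `d` of depth `c₀` with `û_v ≡ t_v mod ϖ_v^c` for all `v ∣ p`. [cite: KhareThorne2017, §6.4]
[cite: Hida1994AIF, §3] -/
theorem exists_globalUnitDatum_forall_valued_sub_le {c₀ b₁ c : ℕ}
    (hb₁ : ∀ v : PlacesAbove K p, ordAt v.1 (p : 𝓞 K) * c₀ ≤ b₁) (hbc : b₁ ≤ c) (h1 : 1 ≤ c)
    (t : ∀ v : PlacesAbove K p, (v.1.adicCompletionIntegers K)ˣ)
    (ht : ∀ v : PlacesAbove K p,
      Valued.v (((t v : v.1.adicCompletionIntegers K) : v.1.adicCompletion K) - 1) ≤ WithZero.exp (-(b₁ : ℤ))) :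
    ∃ d : GlobalUnitDatum K p c₀, ∀ v : PlacesAbove K p,
      Valued.v (((t v : v.1.adicCompletionIntegers K) : v.1.adicCompletion K) -
        ((d.û v.1 v.2 : v.1.adicCompletionIntegers K) : v.1.adicCompletion K)) ≤ WithZero.exp (-(c : ℤ)) := by
  obtain ⟨u, hu⟩ := exists_forall_valued_sub_le (K := K) (p := p) c fun v => (t v : v.1.adicCompletionIntegers K)
  -- local units equal to `u`
  have hunit : ∀ v : PlacesAbove K p, ∃ b : (v.1.adicCompletionIntegers K)ˣ,
      ((b : v.1.adicCompletionIntegers K) : v.1.adicCompletion K) = algebraMap K (v.1.adicCompletion K) (u : K) := by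
    intro v
    obtain ⟨b, hb, -⟩ := exists_unit_eq_of_valued_sub_le (t v) (algebraMap K (v.1.adicCompletion K) (u : K)) h1 (hu v)
    exact ⟨b, hb⟩
  choose b hb using hunit
  -- the congruence `u ≡ 1 (mod p^{c₀})`
  have hcong : (p : 𝓞 K) ^ c₀ ∣ u - 1 := by
    rw [← Ideal.mem_span_singleton, ← Nat.cast_pow]
    refine mem_span_natCast_pow_of_forall p c₀ fun v hv => ?_
    refine Ideal.pow_le_pow_right (hb₁ ⟨v, hv⟩) (sub_one_mem_pow_of_valued_le ?_)
    have := Valuation.map_add Valued.v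
      (algebraMap K (v.adicCompletion K) (u : K) - ((t ⟨v, hv⟩ : v.adicCompletionIntegers K) : v.adicCompletion K))
      (((t ⟨v, hv⟩ : v.adicCompletionIntegers K) : v.adicCompletion K) - 1)
    rw [sub_add_sub_cancel] at this
    exact this.trans (max_le ((hu ⟨v, hv⟩).trans (WithZero.exp_le_exp.2 (by omega))) (ht ⟨v, hv⟩))
  refine ⟨⟨u, fun v hv => b ⟨v, hv⟩, fun v hv => hb ⟨v, hv⟩, hcong⟩, fun v => ?_⟩
  change Valued.v (((t v : v.1.adicCompletionIntegers K) : v.1.adicCompletion K) -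
    ((b ⟨v.1, v.2⟩ : v.1.adicCompletionIntegers K) : v.1.adicCompletion K)) ≤ _
  rw [hb, ← Valuation.map_neg, neg_sub]
  exact hu v

/-- **Torus data approximating local torus elements**: every `u ∈ ∏_{v ∣ p} T_v(b₁)` (`b₁ ≥ e_v c₀`,
`b₁ ≤ c`, `1 ≤ c`) satisfies `u_v (d.units v)⁻¹ ∈ T_v(c)` for some torus datum `d` of depth `c₀`.
[cite: KhareThorne2017, §6.3–6.4] -/
theorem exists_torusDatum_forall_mul_inv_mem_torusBall {c₀ b₁ c : ℕ}
    (hb₁ : ∀ v : PlacesAbove K p, ordAt v.1 (p : 𝓞 K) * c₀ ≤ b₁) (hbc : b₁ ≤ c) (h1 : 1 ≤ c)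
    (u : ∀ v : PlacesAbove K p, Fin 2 → (v.1.adicCompletionIntegers K)ˣ)
    (hu : ∀ v, u v ∈ torusBall v.1 b₁) :
    ∃ d : TorusDatum K p c₀, ∀ v, u v * (d.units v)⁻¹ ∈ torusBall v.1 c := by
  obtain ⟨d₀, hd₀⟩ := exists_globalUnitDatum_forall_valued_sub_le hb₁ hbc h1 (fun v => u v 0)
    fun v => (mem_torusBall_iff _ _ _).1 (hu v) 0
  obtain ⟨d₁, hd₁⟩ := exists_globalUnitDatum_forall_valued_sub_le hb₁ hbc h1 (fun v => u v 1)
    fun v => (mem_torusBall_iff _ _ _).1 (hu v) 1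
  refine ⟨(d₀, d₁), fun v => (mul_inv_mem_torusBall_iff v.1 c (u v) _).2 ?_⟩
  refine Fin.forall_fin_two.2 ⟨?_, ?_⟩
  · rw [TorusDatum.units_zero]; exact hd₀ v
  · rw [TorusDatum.units_one]; exact hd₁ v

end Approximation

namespace TameLevel

variable {K : Type} [Field K] [NumberField K] {p : ℕ} [Fact p.Prime] (𝒰 : TameLevel 2 K p)

/-! ### Torus elements and the Hida levels -/

/-- `torusElement d ∈ U(b, c)` for `b ≤ c₀` (`U` maximal above `p`). [folklore] -/
theorem torusElement_mem_level (h𝒰 : 𝒰.IsMaximalAbove) {c₀ b : ℕ} (hb : b ≤ c₀) (c : ℕ) (d : TorusDatum K p c₀) :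
    d.torusElement ∈ 𝒰.level b c :=
  𝒰.diamondPi_mem_level h𝒰 c d.units fun v => torusBall_antitone v.1 hb (d.units_mem_torusBall v)

/-- `torusElement d` normalises `U(b, c)`. [folklore] -/
theorem torusElement_conj_mem_level (h𝒰 : 𝒰.IsMaximalAbove) (b c : ℕ) {c₀ : ℕ} (d : TorusDatum K p c₀)
    {x : FiniteAdelicGL 2 K} (hx : x ∈ 𝒰.level b c) :
    d.torusElement⁻¹ * x * d.torusElement ∈ 𝒰.level b c :=
  𝒰.diamondPi_conj_mem_level h𝒰 b c d.units hx

/-- `torusElement d` normalises `U(b, c)` (other side). [folklore] -/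
theorem torusElement_conj_mem_level' (h𝒰 : 𝒰.IsMaximalAbove) (b c : ℕ) {c₀ : ℕ} (d : TorusDatum K p c₀)
    {x : FiniteAdelicGL 2 K} (hx : x ∈ 𝒰.level b c) :
    d.torusElement * x * d.torusElement⁻¹ ∈ 𝒰.level b c := by
  have hunits : d.units = (d.units⁻¹)⁻¹ := (inv_inv _).symm
  have h := 𝒰.diamondPi_conj_mem_level h𝒰 b c d.units⁻¹ hx
  rwa [map_inv, inv_inv] at h

/-- **Every coset of `U(b₁, c)/U(c, c)` contains a torus element of depth `c₀`** (`b₁ ≥ e_v c₀` for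
all `v ∣ p`, `b₁ ≤ c`, `1 ≤ c`, `U` maximal above `p`). [cite: KhareThorne2017, §6.3–6.4]
[cite: Hida1994AIF, §3] -/
theorem exists_torusDatum_mul_inv_mem_level (h𝒰 : 𝒰.IsMaximalAbove) {c₀ b₁ c : ℕ}
    (hb₁ : ∀ v : PlacesAbove K p, ordAt v.1 (p : 𝓞 K) * c₀ ≤ b₁) (hbc : b₁ ≤ c) (h1 : 1 ≤ c)
    {s : FiniteAdelicGL 2 K} (hs : s ∈ 𝒰.level b₁ c) :
    ∃ d : TorusDatum K p c₀, s * d.torusElement⁻¹ ∈ 𝒰.level c c := by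
  obtain ⟨u, hu, hsu⟩ := 𝒰.exists_diamondPi_mul_inv_mem_level h𝒰 le_rfl (le_max_of_le_right h1) hs
  obtain ⟨d, hd⟩ := exists_torusDatum_forall_mul_inv_mem_torusBall hb₁ hbc h1 u hu
  refine ⟨d, ?_⟩
  have h2 : diamondPi 2 K p u * d.torusElement⁻¹ ∈ 𝒰.level c c :=
    (𝒰.diamondPi_mul_inv_mem_level_iff h𝒰 c u d.units).2 hd
  have : s * d.torusElement⁻¹ = s * (diamondPi 2 K p u)⁻¹ * (diamondPi 2 K p u * d.torusElement⁻¹) := by group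
  rw [this]
  exact mul_mem hsu h2

/-! ### Symbols -/

/-- The Hecke elements `t_{w,j}` at the GOOD places `w ∉ S`. [cite: KhareThorne2017, §2.4, §6.5] -/
def goodElements : Set (FiniteAdelicGL 2 K) :=
  {g | ∃ w, w ∉ 𝒰.bad ∧ ∃ j : ℕ, g = heckeElement 2 K w j}

/-- `goodElements ⊆ hidaElements`. [folklore] -/
theorem goodElements_subset_hidaElements : 𝒰.goodElements ⊆ 𝒰.hidaElements := by
  rintro _ ⟨w, hw, j, rfl⟩
  exact 𝒰.heckeElement_mem_hidaElements (Or.inl hw) j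

/-- `t_{w,j} ∈ goodElements` for `w ∉ S`. [folklore] -/
theorem heckeElement_mem_goodElements {w : HeightOneSpectrum (𝓞 K)} (hw : w ∉ 𝒰.bad) (j : ℕ) :
    heckeElement 2 K w j ∈ 𝒰.goodElements :=
  ⟨w, hw, j, rfl⟩

/-- **The symbols of the support argument**: good Hecke elements and torus data of depth `c₀`.
[cite: KhareThorne2017, §6.5] -/
abbrev Syms (c₀ : ℕ) : Type :=
  𝒰.goodElements ⊕ TorusDatum K p c₀

/-- `X_d ↦ ∏_{v ∣ p} X_{⟨(û⁰_v, û¹_v)⟩_v}` in `ℤ[T^abs]`. [cite: KhareThorne2017, §6.3] -/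
def torusMonomial {c₀ : ℕ} (d : TorusDatum K p c₀) : MvPolynomial 𝒰.hidaElements ℤ :=
  ∏ v : PlacesAbove K p, X ⟨diamondElement 2 K v.1 (d.units v), 𝒰.diamondElement_mem_hidaElements v.2 _⟩

/-- **`symbolMap : ℤ[Syms] → ℤ[T^abs]`** (`X_g ↦ X_g`, `X_d ↦ torusMonomial d`). [folklore] -/
def symbolMapS (c₀ : ℕ) : MvPolynomial (𝒰.Syms c₀) ℤ →+* MvPolynomial 𝒰.hidaElements ℤ :=
  (bind₁ (Sum.elim (fun g : 𝒰.goodElements => X ⟨g.1, 𝒰.goodElements_subset_hidaElements g.2⟩)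
    (fun d : TorusDatum K p c₀ => 𝒰.torusMonomial d))).toRingHom

/-- `symbolMapS` on a good symbol. [folklore] -/
@[simp]
theorem symbolMapS_X_inl {c₀ : ℕ} (g : 𝒰.goodElements) :
    𝒰.symbolMapS c₀ (X (Sum.inl g)) = X ⟨g.1, 𝒰.goodElements_subset_hidaElements g.2⟩ := by
  simp [symbolMapS]

/-- `symbolMapS` on a torus symbol. [folklore] -/
@[simp]
theorem symbolMapS_X_inr {c₀ : ℕ} (d : TorusDatum K p c₀) :
    𝒰.symbolMapS c₀ (X (Sum.inr d)) = 𝒰.torusMonomial d := by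
  simp [symbolMapS]

/-- `heckePolyHom (torusMonomial d) = ∏_v ⟨(û⁰_v, û¹_v)⟩_v` in `𝕋`. [folklore] -/
theorem heckePolyHom_torusMonomial [Fact 𝒰.IsMaximalAbove] {c₀ : ℕ} (d : TorusDatum K p c₀) :
    𝒰.heckePolyHom (𝒰.torusMonomial d) = ∏ v : PlacesAbove K p, 𝒰.ordDiamond v.2 (d.units v) := by
  rw [torusMonomial, map_prod]
  exact Finset.prod_congr rfl fun v _ => by rw [heckePolyHom_X]; rfl

/-! ### The symbol ring over a coefficient ring `O`: character, twist, weight ideals -/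

section Ring

variable (O : Type) [CommRing O] {A : Type*} [CommRing A] (σ : O →+* A) (c₀ : ℕ)

/-- **The character `O[Syms] → A` with prescribed values on the symbols** (`eval₂Hom σ a`).
[cite: Hida1994AIF, §3] -/
def symChar (a : 𝒰.Syms c₀ → A) : MvPolynomial (𝒰.Syms c₀) O →+* A :=
  eval₂Hom σ a

variable {O σ c₀} in
/-- `symChar` on a symbol. [folklore] -/
@[simp]
theorem symChar_X (a : 𝒰.Syms c₀ → A) (s : 𝒰.Syms c₀) : 𝒰.symChar O σ c₀ a (X s) = a s := by
  rw [symChar, coe_eval₂Hom, eval₂_X]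

variable {O σ c₀} in
/-- `symChar` on a constant. [folklore] -/
@[simp]
theorem symChar_C (a : 𝒰.Syms c₀ → A) (r : O) : 𝒰.symChar O σ c₀ a (C r) = σ r := by
  rw [symChar, coe_eval₂Hom, eval₂_C]

/-- **The weight twist `X_d ↦ N(u¹_d)^{k-2} X_d`** on `O[Syms]` (identity on the good symbols and on
`O`). [cite: KhareThorne2017, §6.4] -/
def symTwist (k : ℕ) : MvPolynomial (𝒰.Syms c₀) O →+* MvPolynomial (𝒰.Syms c₀) O :=
  (bind₁ (Sum.elim (fun g : 𝒰.goodElements => (X (Sum.inl g) : MvPolynomial (𝒰.Syms c₀) O))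
    (fun d : TorusDatum K p c₀ => C ((Algebra.norm ℤ d.2.u : ℤ) ^ (k - 2) : O) * X (Sum.inr d)))).toRingHom

variable {O c₀} in
/-- `symTwist` on a good symbol. [folklore] -/
@[simp]
theorem symTwist_X_inl (k : ℕ) (g : 𝒰.goodElements) :
    𝒰.symTwist O c₀ k (X (Sum.inl g)) = X (Sum.inl g) := by
  simp [symTwist]

variable {O c₀} in
/-- `symTwist` on a torus symbol. [folklore] -/
@[simp]
theorem symTwist_X_inr (k : ℕ) (d : TorusDatum K p c₀) :
    𝒰.symTwist O c₀ k (X (Sum.inr d)) = C ((Algebra.norm ℤ d.2.u : ℤ) ^ (k - 2) : O) * X (Sum.inr d) := by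
  simp [symTwist]

variable {O c₀} in
/-- `symTwist` fixes the constants. [folklore] -/
@[simp]
theorem symTwist_C (k : ℕ) (r : O) : 𝒰.symTwist O c₀ k (C r) = C r := by
  simp [symTwist]

/-- **The weight ideal of a finite family of torus data**: `(N(u¹_{a t})^{k-2} X_{a t} - 1)_t`
(`Ideal.span` of a `Fin`-indexed family, the shape used by the dual-annihilator lemma).
[cite: KhareThorne2017, §6.4] -/
def symWeightIdeal (k : ℕ) {m : ℕ} (a : Fin m → TorusDatum K p c₀) : Ideal (MvPolynomial (𝒰.Syms c₀) O) :=
  Ideal.span (Set.range fun t : Fin m => 𝒰.symTwist O c₀ k (X (Sum.inr (a t))) - 1)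

/-- The generators of the weight ideal, as a `Fin`-indexed family. [folklore] -/
def symWeightGen (k : ℕ) {m : ℕ} (a : Fin m → TorusDatum K p c₀) : Fin m → MvPolynomial (𝒰.Syms c₀) O :=
  fun t => 𝒰.symTwist O c₀ k (X (Sum.inr (a t))) - 1

variable {O c₀} in
/-- `symWeightIdeal = span (range symWeightGen)` (definitional). [folklore] -/
theorem symWeightIdeal_eq (k : ℕ) {m : ℕ} (a : Fin m → TorusDatum K p c₀) :
    𝒰.symWeightIdeal O c₀ k a = Ideal.span (Set.range (𝒰.symWeightGen O c₀ k a)) :=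
  rfl

variable {O σ c₀} in
/-- **A character with `χ(symTwist (X_{a t})) = 1` kills the weight ideal.** [folklore] -/
theorem symChar_eq_zero_of_mem_symWeightIdeal (a : 𝒰.Syms c₀ → A) (k : ℕ) {m : ℕ}
    (b : Fin m → TorusDatum K p c₀)
    (h : ∀ t, 𝒰.symChar O σ c₀ a (𝒰.symTwist O c₀ k (X (Sum.inr (b t)))) = 1)
    {r : MvPolynomial (𝒰.Syms c₀) O} (hr : r ∈ 𝒰.symWeightIdeal O c₀ k b) :
    𝒰.symChar O σ c₀ a r = 0 := by
  rw [← RingHom.mem_ker]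
  refine (Ideal.span_le.2 ?_) hr
  rintro _ ⟨t, rfl⟩
  rw [SetLike.mem_coe, RingHom.mem_ker, map_sub, map_one, h t, sub_self]

end Ring

/-! ### The values of a point of `𝕋^{S,ord}` on the symbols -/

section Point

variable [Fact 𝒰.IsMaximalAbove] {A : Type*} [CommRing A] (x : OrdinaryHeckeAlgebraGLn 𝒰 →+* A) (c₀ : ℕ)

/-- **The values of a point `x` on the symbols**: `X_g ↦ x(ordOp g)`, `X_d ↦ ∏_v x⟨(û⁰_v, û¹_v)⟩_v`.
[cite: KhareThorne2017, §6.5] -/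
def symValues : 𝒰.Syms c₀ → A :=
  Sum.elim (fun g : 𝒰.goodElements => x (𝒰.ordOp (𝒰.goodElements_subset_hidaElements g.2)))
    (fun d : TorusDatum K p c₀ => ∏ v : PlacesAbove K p, x (𝒰.ordDiamond v.2 (d.units v)))

variable {c₀} in
/-- `symValues` on a good symbol. [folklore] -/
@[simp]
theorem symValues_inl (g : 𝒰.goodElements) :
    𝒰.symValues x c₀ (Sum.inl g) = x (𝒰.ordOp (𝒰.goodElements_subset_hidaElements g.2)) :=
  rfl

variable {c₀} in
/-- `symValues` on a torus symbol. [folklore] -/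
@[simp]
theorem symValues_inr (d : TorusDatum K p c₀) :
    𝒰.symValues x c₀ (Sum.inr d) = ∏ v : PlacesAbove K p, x (𝒰.ordDiamond v.2 (d.units v)) :=
  rfl

variable {c₀} in
/-- **The values are those of `x ∘ heckePolyHom ∘ symbolMap` on the symbols** (`X_d` maps to
`∏_v X_{⟨(û⁰,û¹)⟩_v}` and `x` is multiplicative). [folklore] -/
theorem symValues_eq_apply_heckePolyHom_symbolMapS (s : 𝒰.Syms c₀) :
    𝒰.symValues x c₀ s = x (𝒰.heckePolyHom (𝒰.symbolMapS c₀ (X s))) := by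
  rcases s with g | d
  · rw [symValues_inl, symbolMapS_X_inl, heckePolyHom_X]
  · rw [symValues_inr, symbolMapS_X_inr, heckePolyHom_torusMonomial, map_prod]

variable {c₀} in
/-- `∏_v x⟨(û⁰_v, û¹_v)⟩_v = (∏_v x⟨(û⁰_v, 1)⟩_v) (∏_v x⟨(1, û¹_v)⟩_v)` (the diamond homomorphism is
multiplicative). [folklore] -/
theorem prod_apply_ordDiamond_units (d : TorusDatum K p c₀) :
    (∏ v : PlacesAbove K p, x (𝒰.ordDiamond v.2 (d.units v))) =
      (∏ v : PlacesAbove K p, x (𝒰.ordDiamond v.2 (Pi.mulSingle (0 : Fin 2) (d.1.û v.1 v.2)))) *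
        ∏ v : PlacesAbove K p, x (𝒰.ordDiamond v.2 (Pi.mulSingle (1 : Fin 2) (d.2.û v.1 v.2))) := by
  have h𝒰 : 𝒰.IsMaximalAbove := Fact.out
  rw [← Finset.prod_mul_distrib]
  refine Finset.prod_congr rfl fun v _ => ?_
  rw [← map_mul, d.units_eq_mulSingle_mul, ← ordDiamondHom_apply 𝒰 h𝒰 v.2, map_mul, ordDiamondHom_apply,
    ordDiamondHom_apply]

/-- **A point with the weight-`k` diamond values is `1` on the twisted torus symbols**:
if `∏_v x⟨(1, û_v)⟩_v = N(u)^{2-k}` and `∏_v x⟨(û_v, 1)⟩_v = 1` for all global unit data of depth `c₀`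
(and `A` is a field of characteristic zero, `k ≥ 2`), then `symChar σ (symValues x) (symTwist k X_d) = 1`.
[cite: Hida1994AIF, §3] [cite: KhareThorne2017, §6.5] -/
theorem symChar_symTwist_X_inr_eq_one {A : Type*} [Field A] [CharZero A] (x : OrdinaryHeckeAlgebraGLn 𝒰 →+* A)
    (O : Type) [CommRing O] (σ : O →+* A) {k : ℕ} (hk : 2 ≤ k)
    (h₁ : ∀ d : GlobalUnitDatum K p c₀,
      (∏ v : PlacesAbove K p, x (𝒰.ordDiamond v.2 (Pi.mulSingle (1 : Fin 2) (d.û v.1 v.2)))) =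
        ((Algebra.norm ℤ d.u : ℤ) : A) ^ (2 - (k : ℤ)))
    (h₀ : ∀ d : GlobalUnitDatum K p c₀,
      (∏ v : PlacesAbove K p, x (𝒰.ordDiamond v.2 (Pi.mulSingle (0 : Fin 2) (d.û v.1 v.2)))) = 1)
    (d : TorusDatum K p c₀) :
    𝒰.symChar O σ c₀ (𝒰.symValues x c₀) (𝒰.symTwist O c₀ k (X (Sum.inr d))) = 1 := by
  rw [symTwist_X_inr, map_mul, symChar_C, symChar_X, symValues_inr, prod_apply_ordDiamond_units, h₀ d.1,
    one_mul, h₁ d.2, map_pow, map_intCast]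
  have hN : ((Algebra.norm ℤ d.2.u : ℤ) : A) ≠ 0 := Int.cast_ne_zero.2 d.2.norm_ne_zero
  rw [← zpow_natCast, ← zpow_add₀ hN, Nat.cast_sub hk]
  norm_num

/-- **Depth at which a continuous dominant point of weight `k` is `1` on all twisted torus
symbols.** [cite: Hida1994AIF, §1 p. 1293, §3] [cite: KhareThorne2017, §6.4, Cor. 6.15] -/
theorem exists_depth_forall_symChar_symTwist_eq_one (x : OrdinaryHeckeAlgebraGLn 𝒰 →+* PadicAlgCl p)
    (hx : Continuous x) {k : ℕ} (hk : 2 ≤ k) (h : 𝒰.HasDominantDiamondWeight x k)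
    (O : Type) [CommRing O] (σ : O →+* PadicAlgCl p) :
    ∃ c₀ : ℕ, ∀ c₀', c₀ ≤ c₀' → ∀ d : TorusDatum K p c₀',
      𝒰.symChar O σ c₀' (𝒰.symValues x c₀') (𝒰.symTwist O c₀' k (X (Sum.inr d))) = 1 := by
  have h𝒰 : 𝒰.IsMaximalAbove := Fact.out
  obtain ⟨c₀, hc₀⟩ := HasDominantDiamondWeight.exists_forall_eq h𝒰 hx h
  refine ⟨c₀, fun c₀' hle d => 𝒰.symChar_symTwist_X_inr_eq_one c₀' x O σ hk (fun d' => ?_) (fun d' => ?_) d⟩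
  · have h1 := (hc₀ d'.u d'.û d'.compat ((pow_dvd_pow _ hle).trans d'.cong)).1
    rwa [finprod_eq_prod_of_fintype] at h1
  · have h0 := (hc₀ d'.u d'.û d'.compat ((pow_dvd_pow _ hle).trans d'.cong)).2
    rwa [finprod_eq_prod_of_fintype] at h0

end Point

end TameLevel

end BigHeckeGLn

end Literature.NumberTheory.Automorphic
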